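import Literature.NumberTheory.EllipticCurves.ComplexMultiplicationShaRubinInflationProofs
import Literature.NumberTheory.EllipticCurves.HeegnerPointsKolyvaginLocalCriterion
import Literature.NumberTheory.EllipticCurves.ZpExtension
import HarnessLib

/-!
# `H¹(L/K, E(L)[p^j]) = 0` along the tower `L ⊆ K_∞(E[p^∞])` from ONE homothety on `E[p]`
# (Howard 2004a, hypothesis H.2; Lawson–Wuthrich 2016, Lemma 3, in tower form)

`Proofs`-style file (THEOREMS ONLY: no definition, no named fact, no instance), topic
`NumberTheory/EllipticCurves`.

## What is proved

Let `E/K` be an elliptic curve over any field (model `W`), `p` a prime, and let ONE `σ ∈ Γ_K` act on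
`E[p] = E(K̄)[p]` as a homothety `a ∈ ℤ` with `p ∤ a − 1` (e.g. `a = −1`, `p` odd). Then for every
open normal `N ⊴ Γ_K` containing `Γ_{K(E[p^k])} ⊓ Λ`, where `Λ ≤ Γ_K` is any subgroup containing
all commutators (`Λ = Gal(K̄/K')` for an ABELIAN `K'/K`, e.g. `ker κ` or `κ⁻¹(p^b ℤ_p)` for a
`ℤ_p`-extension `κ`), and every `j ≤ k`: `subgroupResKer (geomTorsion W (p^j)) N = ⊥`, i.e.
`ker (H¹(Γ_K, E[p^j]) → H¹(N, E[p^j])) = 0` — `H¹(Gal(L/K), E(L)[p^j]) = 0` for every finite Galois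
`L/K` inside `K'(E[p^k])`; restriction is injective all along the tower `K ⊆ L ⊆ K_∞(E[p^∞])`.

* `smul_eq_zsmul_of_pow_of_torsionBy` — LIFTING LEMMA (pure algebra, a monoid acting on an abelian
  group): `σ ≡ a` on `A[p]` ⇒ `σ^{p^m} ≡ a^{p^m}` on `A[p^{m+1}]` (`σ − a` lowers the `p`-power
  filtration by one, so `σ^{p^m} − a^{p^m}` lowers it by `m + 1`; the binomial mechanism
  `(c + D)^p ≡ c^p + p c^{p−1} D (mod D²)` run as an induction, no coordinates);
* `LawsonWuthrich2016.subgroupResKer_geomTorsion_eq_bot_of_homothety` — the displayed statement;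
  `…_of_homothety_layer` / `…_of_homothety_ker` — `Λ = κ.layerSubgroup b` / `κ.kerSubgroup` for
  `κ : ZpExtension K p`; `…_prime_eq_bot_of_homothety[_layer]` — `E[p]`-coefficients (Howard's `T̄`);
  `…_of_smul_eq_neg` — `a = −1`, `p` odd.

Mechanism: `g₀ = σ^{p^{k−1}}` acts on `E[p^k]` as the scalar `c = a^{p^{k−1}}`, so it is CENTRAL modulo
`Γ_{K(E[p^k])} ⊓ Λ` and `P ↦ g₀P − P = (c − 1)P` is bijective on subgroups of `E[p^j]` (`p ∤ c − 1`); the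
tree's Sah lemma modulo `N`, `Rubin1987.subgroupResKer_eq_bot_of_bijOn`, kills the restriction kernel.

## Why this file exists (cell `pub/bsd-print-x9`, rows 9/10; seat `bsd-line-x10b-p1-w2` g5, 2026-08-28)

Howard's `Λ`-adic Kolyvagin-system bound (Compositio 140 (2004), Thm. 2.2.10, via the DVR bound) asks
in hypothesis **H.2** (§2.3) for a Galois `F/ℚ ⊇ K` with `G_F` trivial on `T` and
`H¹(F(μ_{p^∞})/K, T̄) = 0`, CONSUMED (Lemma 2.6.2, the Čebotarev step) only as "restriction
`H¹(K, T̄) → H¹(L, T̄)` is injective for the finite Galois `L ⊆ F(μ_{p^∞})` cut out by `T/𝔪^{2k−1}T`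
and `μ_{p^{2k−1}}`". For `T = T_pE ⊗ Λ/𝔮` (the port of Thm. 2.2.10 at `𝔮 = (T^m + p)` wanted by the
cell's shared `μ`-item `HeegnerMuPartStabilized.MuPartStabilizedOfPrint`): `T̄ = E[p]`,
`F = K_∞(E[p^∞])`, and every such `L` lies in some `K_b(E[p^k])`, of absolute Galois group
`Γ_{K(E[p^k])} ⊓ κ⁻¹(p^bℤ_p)`. Howard verifies H.2 only for SURJECTIVE `ρ_{E,p}` (homotheties
`μ_{p−1} ⊂ GL₂(ℤ_p)`, proofs of Thm. 2.6.5 / Prop. 3.1.3); ONE homothety `≢ 1` on `E[p]` suffices,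
and the small-image frames of rows 9/10 have one: `p = 3` (X10b) `a = −1` (images `N(C_s)`, `N(C_ns)`
∋ `−I`; Lawson–Wuthrich Lemma 4 at `p = 3`), `p = 5, 7` (X9) Lawson–Wuthrich Lemma 4 (`p ∤ d_K` ⇒
`K ∩ ℚ(μ_p) = ℚ`). The homothety stays an explicit HYPOTHESIS here (a finite per-curve certificate).
«beyond-print theorem»: no (Lawson–Wuthrich Lemma 3 / Cha Thm. 7 / Sah). BSD is NOT proved by this file.

References: B. Howard, Compositio Math. 140 (2004), §2.3 (H.2), Lemma 2.6.2, proofs of Thm. 2.6.5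
and Prop. 3.1.3 [Howard2004HeegnerKolyvagin]; T. Lawson, C. Wuthrich, in *Elliptic curves, modular
forms and Iwasawa theory* (2016), Lemma 3, Lemma 4 [LawsonWuthrich2016]; B. Cha, J. Number Theory
111 (2005), Thm. 7 [Cha2005]; C.-H. Sah, J. Algebra 10 (1968), Prop. 2.7 (b) [Sah1968]; K. Rubin,
LNM 1716 (1999), Lemma 6.2 (i) (the tree's `Rubin1987.subgroupResKer_eq_bot_of_bijOn`) [Rubin1999];
Dixon–du Sautoy–Mann–Segal, *Analytic pro-p groups*, §5.1 (lifting device) [DixonDuSautoyMannSegal1999].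
-/

set_option autoImplicit false

noncomputable section

open scoped Classical

open WeierstrassCurve Field Literature.NumberTheory.GaloisRepresentations

universe u

namespace Literature.NumberTheory.EllipticCurves

/-! ### §1 The lifting lemma: `σ ≡ a` on `A[p]` ⇒ `σ^{p^m} ≡ a^{p^m}` on `A[p^{m+1}]` -/

section Lifting

variable {G : Type*} [Monoid G] {A : Type*} [AddCommGroup A] [DistribMulAction G A]

/-- Enlarging the exponent keeps an element killed: `p^i • y = 0`, `i ≤ l` ⇒ `p^l • y = 0`. [folklore] -/
private theorem pow_nsmul_eq_zero_of_le {p i l : ℕ} {y : A} (hy : p ^ i • y = 0) (hil : i ≤ l) :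
    p ^ l • y = 0 := by
  obtain ⟨d, rfl⟩ := Nat.exists_eq_add_of_le hil
  rw [pow_add, mul_comm, mul_smul, hy, smul_zero]

/-- If `τ − c` lowers the `p`-power filtration of `A` by `r` (`p^j x = 0 ⇒ p^{j−r}(τx − cx) = 0`),
then so does `τ^i − c^i` for every `i`:
`τ^{i+1}x − c^{i+1}x = τ(τ^i x − c^i x) + c^i(τx − cx)`. [folklore] -/
private theorem pow_smul_sub_pow_zsmul_lowers {p r : ℕ} {τ : G} {c : ℤ}
    (hτ : ∀ (j : ℕ) (x : A), p ^ j • x = 0 → p ^ (j - r) • (τ • x - c • x) = 0)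
    (i j : ℕ) (x : A) (hx : p ^ j • x = 0) :
    p ^ (j - r) • (τ ^ i • x - c ^ i • x) = 0 := by
  induction i with
  | zero => rw [pow_zero, pow_zero, one_smul, one_smul, sub_self, nsmul_zero]
  | succ i ih =>
    have hsplit : τ ^ (i + 1) • x - c ^ (i + 1) • x =
        τ • (τ ^ i • x - c ^ i • x) + c ^ i • (τ • x - c • x) := by
      rw [pow_succ' τ i, pow_succ c i, mul_smul, mul_smul, smul_sub, smul_sub,
        smul_comm τ (c ^ i) x]
      abel
    rw [hsplit, smul_add, smul_comm (p ^ (j - r)) τ, ih, smul_zero, zero_add,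
      smul_comm (p ^ (j - r)) (c ^ i), hτ j x hx, smul_zero]

/-- The `p`-th power step. If `τ − c` lowers the `p`-power filtration by `r ≥ 1`, then `τ^p − c^p`
lowers it by `r + 1`: with `y = τx − cx` one has `τ^n x − c^n x ≡ n c^{n−1} y` modulo elements
killed by `p^{j−2r}` (induction on `n`), and at `n = p` the main term `p c^{p−1} y` has gained a
factor `p`. This is the mechanism `(c + D)^p ≡ c^p + p c^{p−1}D (mod D²)` behind
`(1 + pM₂(ℤ_p))^{p^m} ⊆ 1 + p^{m+1}M₂(ℤ_p)`, run without coordinates (the `p`-power map on the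
congruence filtration of `GL_d(ℤ_p)`, Dixon–du Sautoy–Mann–Segal §5.1).
[cite: DixonDuSautoyMannSegal1999, §5.1 Lemma 5.1 (p-power map on the congruence filtration of GL_d(ℤ_p))] -/
theorem pow_prime_smul_sub_zsmul_lowers {p r : ℕ} (hr : 1 ≤ r) {τ : G} {c : ℤ}
    (hτ : ∀ (j : ℕ) (x : A), p ^ j • x = 0 → p ^ (j - r) • (τ • x - c • x) = 0)
    (j : ℕ) (x : A) (hx : p ^ j • x = 0) :
    p ^ (j - (r + 1)) • (τ ^ p • x - c ^ p • x) = 0 := by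
  -- additive maps preserve the filtration
  have hτfilt : ∀ (l : ℕ) (z : A), p ^ l • z = 0 → p ^ l • (τ • z) = 0 := fun l z hz ↦ by
    rw [smul_comm, hz, smul_zero]
  set y : A := τ • x - c • x with hy_def
  clear_value y
  have hy : p ^ (j - r) • y = 0 := by rw [hy_def]; exact hτ j x hx
  -- `τ y − c y` is killed by `p^{j−2r}`
  have hτy : p ^ (j - r - r) • (τ • y - c • y) = 0 := hτ (j - r) y hy
  -- the congruence `τ^n x − c^n x = n c^{n−1} y + e_n`, `p^{j−2r} e_n = 0`
  have key : ∀ n : ℕ, p ^ (j - r - r) •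
      (τ ^ n • x - c ^ n • x - ((n : ℤ) * c ^ (n - 1)) • y) = 0 := by
    intro n
    induction n with
    | zero => simp
    | succ n ih =>
      -- `τ^{n+1}x − c^{n+1}x = τ(τ^n x − c^n x) + c^n y`
      have hsplit : τ ^ (n + 1) • x - c ^ (n + 1) • x =
          τ • (τ ^ n • x - c ^ n • x) + c ^ n • y := by
        rw [hy_def, pow_succ' τ n, pow_succ c n, mul_smul, mul_smul, smul_sub, smul_sub,
          smul_comm τ (c ^ n) x]
        abel
      -- rewrite `τ^n x − c^n x` through the induction hypothesis' error term
      set e : A := τ ^ n • x - c ^ n • x - ((n : ℤ) * c ^ (n - 1)) • y with he_def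
      clear_value e
      have he : p ^ (j - r - r) • e = 0 := ih
      have h1 : τ ^ n • x - c ^ n • x = ((n : ℤ) * c ^ (n - 1)) • y + e := by
        rw [he_def]; abel
      -- `n c^{n-1} · c = n c^n` (both sides vanish for `n = 0`)
      have hcoef : (n : ℤ) * c ^ (n - 1) * c = (n : ℤ) * c ^ n := by
        rcases Nat.eq_zero_or_pos n with rfl | hn
        · simp
        · rw [mul_assoc, ← pow_succ, Nat.sub_add_cancel hn]
      have h2 : τ ^ (n + 1) • x - c ^ (n + 1) • x - (((n + 1 : ℕ) : ℤ) * c ^ (n + 1 - 1)) • y =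
          ((n : ℤ) * c ^ (n - 1)) • (τ • y - c • y) + τ • e := by
        rw [hsplit, h1, smul_add, smul_comm τ ((n : ℤ) * c ^ (n - 1)) y, Nat.add_sub_cancel,
          Nat.cast_succ, smul_sub, smul_smul, hcoef, add_mul, one_mul, add_smul]
        abel
      rw [h2, smul_add, smul_comm (p ^ (j - r - r)) ((n : ℤ) * c ^ (n - 1)), hτy, smul_zero,
        zero_add, hτfilt _ _ he]
  -- at `n = p`: `τ^p x − c^p x = p c^{p−1} y + e_p`
  have hmain := key p
  set e : A := τ ^ p • x - c ^ p • x - ((p : ℤ) * c ^ (p - 1)) • y with he_def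
  have he : p ^ (j - (r + 1)) • e = 0 :=
    pow_nsmul_eq_zero_of_le hmain (by omega)
  have h1 : τ ^ p • x - c ^ p • x = c ^ (p - 1) • (p • y) + e := by
    rw [he_def, ← natCast_zsmul y p, smul_smul, mul_comm]
    abel
  have hpy : p ^ (j - (r + 1)) • (p • y) = 0 := by
    rw [← mul_nsmul', ← pow_succ]
    exact pow_nsmul_eq_zero_of_le hy (by omega)
  rw [h1, nsmul_add, he, add_zero, smul_comm, hpy, smul_zero]

/-- **Lifting lemma.** If `σ` acts on the `p`-torsion `A[p]` as the integer `a`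
(`p x = 0 ⇒ σ x = a x`), then `σ^{p^m} − a^{p^m}` lowers the `p`-power filtration by `m + 1`:
`p^j x = 0 ⇒ p^{j−(m+1)} (σ^{p^m} x − a^{p^m} x) = 0`. [folklore] -/
private theorem pow_pow_smul_sub_zsmul_lowers (p : ℕ) {σ : G} {a : ℤ}
    (hσ : ∀ x : A, p • x = 0 → σ • x = a • x) (m j : ℕ) (x : A) (hx : p ^ j • x = 0) :
    p ^ (j - (m + 1)) • (σ ^ p ^ m • x - a ^ p ^ m • x) = 0 := by
  induction m generalizing j x with
  | zero =>
    cases j with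
    | zero =>
      rw [pow_zero, one_smul] at hx
      simp [hx]
    | succ j' =>
      rw [pow_succ', mul_smul] at hx
      simp only [pow_zero, pow_one, zero_add, Nat.add_sub_cancel]
      rw [smul_sub, smul_comm (p ^ j') σ x, smul_comm (p ^ j') a x, hσ _ hx, sub_self]
  | succ m ih =>
    have h := pow_prime_smul_sub_zsmul_lowers (p := p) (r := m + 1) (by omega)
      (τ := σ ^ p ^ m) (c := a ^ p ^ m) (fun j x hx ↦ ih j x hx) j x hx
    rw [← pow_mul, ← pow_mul] at h
    exact h

/-- **Lifting lemma, pointwise form.** If `σ` acts on `A[p]` as the integer `a`, then `σ^{p^m}`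
acts on `A[p^{m+1}]` as the integer `a^{p^m}`. (For `a = −1`, `p` odd: an element acting as `−1`
on `E[p]` has a power acting as `−1` on `E[p^{m+1}]`; in `GL₂(ℤ_p)`: a lift of `−I` has the
`p^m`-th powers converging to `−I` — the congruence filtration `GL_d^i(ℤ_p)` has
`(GL_d^i)^p ⊆ GL_d^{i+1}`, Dixon–du Sautoy–Mann–Segal §5.1.)
[cite: DixonDuSautoyMannSegal1999, §5.1 Lemma 5.1 / Thm. 5.2 (congruence filtration of GL_d(ℤ_p))] -/
theorem smul_eq_zsmul_of_pow_of_torsionBy (p : ℕ) {σ : G} {a : ℤ}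
    (hσ : ∀ x : A, p • x = 0 → σ • x = a • x) (m : ℕ) (x : A) (hx : p ^ (m + 1) • x = 0) :
    σ ^ p ^ m • x = a ^ p ^ m • x := by
  have h := pow_pow_smul_sub_zsmul_lowers p hσ m (m + 1) x hx
  rwa [Nat.sub_self, pow_zero, one_smul, sub_eq_zero] at h

end Lifting

/-! ### §2 Coprimality: `p ∤ a − 1 ⇒ p ∤ a^{p^m} − 1`, and `(c − 1)•` is injective on `A[p^j]` -/

section Coprime
/-- Fermat: `a^{p^m} ≡ a (mod p)`, so `p ∤ a − 1 ⇒ p ∤ a^{p^m} − 1`. [folklore] -/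
private theorem not_dvd_pow_pow_sub_one {p : ℕ} (hp : p.Prime) {a : ℤ} (ha : ¬ (p : ℤ) ∣ a - 1) (m : ℕ) :
    ¬ (p : ℤ) ∣ a ^ p ^ m - 1 := by
  haveI := Fact.mk hp
  have hmod : ((a ^ p ^ m - 1 : ℤ) : ZMod p) = ((a - 1 : ℤ) : ZMod p) := by
    push_cast
    congr 1
    induction m with
    | zero => rw [pow_zero, pow_one]
    | succ m ih => rw [pow_succ, pow_mul, ih, ZMod.pow_card]
  rw [← ZMod.intCast_zmod_eq_zero_iff_dvd, hmod, ZMod.intCast_zmod_eq_zero_iff_dvd]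
  exact ha

variable {A : Type*} [AddCommGroup A]

/-- If `p ∤ d` then `x ↦ d • x` is injective on the `p^j`-torsion of an abelian group
(Bézout: `u d + v p^j = 1`). [folklore] -/
private theorem zsmul_injOn_of_not_dvd {p : ℕ} (hp : p.Prime) {d : ℤ} (hd : ¬ (p : ℤ) ∣ d) (j : ℕ)
    {x y : A} (hx : p ^ j • x = 0) (hy : p ^ j • y = 0) (h : d • x = d • y) : x = y := by
  have hcop : IsCoprime d ((p : ℤ) ^ j) :=
    IsCoprime.pow_right ((Nat.prime_iff_prime_int.1 hp).irreducible.coprime_iff_not_dvd.2 hd).symm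
  obtain ⟨u, v, huv⟩ := hcop
  rw [← sub_eq_zero] at h ⊢
  have hz : p ^ j • (x - y) = 0 := by rw [nsmul_sub, hx, hy, sub_self]
  calc x - y = (u * d + v * (p : ℤ) ^ j) • (x - y) := by rw [huv, one_smul]
    _ = u • (d • (x - y)) + v • ((p ^ j : ℕ) : ℤ) • (x - y) := by
        rw [add_smul, mul_smul, mul_smul, Nat.cast_pow]
    _ = 0 := by rw [smul_sub, h, smul_zero, zero_add, natCast_zsmul, hz, smul_zero]

end Coprime

/-! ### §3 `H¹` along the division tower from one homothety (Howard H.2 / Lawson–Wuthrich Lemma 3) -/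

namespace LawsonWuthrich2016

variable {K : Type u} [Field K] (W : WeierstrassCurve K) {p : ℕ}

/-- A homothety on `E[p]`, read on geometric points: `σ • P = a • P` whenever `p P = 0`. [folklore] -/
private theorem smul_eq_zsmul_of_geomTorsion {σ : absoluteGaloisGroup K} {a : ℤ}
    (hσ : ∀ P : geomTorsion W (p : ℤ), σ • P = a • P) (P : geomPoints W) (hP : p • P = 0) :
    σ • P = a • P := by
  have hmem : P ∈ geomTorsion W (p : ℤ) := by
    rw [mem_geomTorsion_iff, natCast_zsmul]; exact hP
  have h := congrArg (fun Q : geomTorsion W (p : ℤ) ↦ (Q : geomPoints W)) (hσ ⟨P, hmem⟩)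
  simpa only [AddSubgroup.torsionBy.coe_smul, AddSubgroupClass.coe_zsmul] using h

/-- **`H¹` vanishing along the division tower from one homothety** (Howard 2004a hypothesis H.2 in
the form consumed by his Lemma 2.6.2; Lawson–Wuthrich 2016 Lemma 3 / Cha 2005 Thm. 7, tower form).
Let `E/K` be an elliptic curve, `p` a prime, and `σ ∈ Γ_K` an element acting on `E[p]` as a
homothety `a` with `p ∤ a − 1`. Let `Λ ≤ Γ_K` contain all commutators (e.g. `Λ = Gal(K̄/K')` for an
ABELIAN `K'/K`, such as the anticyclotomic `ℤ_p`-tower), and let `N ⊴ Γ_K` be open with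
`Γ_{K(E[p^{m+1}])} ⊓ Λ ≤ N` (so `N = Gal(K̄/L)` for a finite Galois `L ⊆ K'(E[p^{m+1}])`). Then for
every `j ≤ m + 1` the restriction `H¹(Γ_K, E[p^j]) → H¹(N, E[p^j])` is injective:
`H¹(Gal(L/K), E(L)[p^j]) = 0`. Proof: `g₀ = σ^{p^m}` acts on `E[p^{m+1}]` as `c = a^{p^m}`
(`smul_eq_zsmul_of_pow_of_torsionBy`), hence is central modulo `Γ_{K(E[p^{m+1}])} ⊓ Λ`, and
`P ↦ g₀P − P = (c − 1)P` is a bijection of the `N`-invariants of `E[p^j]` (`p ∤ c − 1`); conclude by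
the tree's Sah lemma modulo `N`, `Rubin1987.subgroupResKer_eq_bot_of_bijOn`.
[cite: Howard2004HeegnerKolyvagin, §2.3 hypothesis H.2 and Lemma 2.6.2; proofs of Thm. 2.6.5, Prop. 3.1.3]
[cite: LawsonWuthrich2016, Lemma 3] [cite: Cha2005, Thm. 7] [cite: Sah1968, Prop. 2.7 (b)] -/
theorem subgroupResKer_geomTorsion_eq_bot_of_homothety [W.IsElliptic] (hp : p.Prime) {σ : absoluteGaloisGroup K} {a : ℤ}
    (hσ : ∀ P : geomTorsion W (p : ℤ), σ • P = a • P) (ha : ¬ (p : ℤ) ∣ a - 1)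
    (Λ : Subgroup (absoluteGaloisGroup K)) (hΛ : ∀ g h : absoluteGaloisGroup K, g * h * g⁻¹ * h⁻¹ ∈ Λ) {m j : ℕ} (hj : j ≤ m + 1)
    (N : Subgroup (absoluteGaloisGroup K)) [N.Normal] (hN : IsOpen (N : Set (absoluteGaloisGroup K)))
    (hle : torsionFixing W ((p : ℤ) ^ (m + 1)) ⊓ Λ ≤ N) :
    subgroupResKer (geomTorsion W ((p : ℤ) ^ j)) N = ⊥ := by
  -- the scalar `c = a^{p^m}` through which `g₀ = σ^{p^m}` acts on `E[p^{m+1}]`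
  set g₀ : absoluteGaloisGroup K := σ ^ p ^ m with hg₀
  set c : ℤ := a ^ p ^ m with hc
  have hσ' : ∀ P : geomPoints W, p • P = 0 → σ • P = a • P :=
    smul_eq_zsmul_of_geomTorsion W hσ
  have hg₀c : ∀ P : geomPoints W, p ^ (m + 1) • P = 0 → g₀ • P = c • P :=
    fun P hP ↦ smul_eq_zsmul_of_pow_of_torsionBy p hσ' m P hP
  have hc1 : ¬ (p : ℤ) ∣ c - 1 := not_dvd_pow_pow_sub_one hp ha m
  -- torsion levels, on geometric points
  have htor : ∀ {l : ℕ} (P : geomTorsion W ((p : ℤ) ^ l)), p ^ l • (P : geomPoints W) = 0 :=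
    fun {l} P ↦ by
      have h := (mem_geomTorsion_iff W ((p : ℤ) ^ l) (P : geomPoints W)).1 P.2
      have h2 : ((p ^ l : ℕ) : ℤ) • (P : geomPoints W) = 0 := by rw [Nat.cast_pow]; exact h
      rwa [natCast_zsmul] at h2
  have htor' : ∀ (P : geomTorsion W ((p : ℤ) ^ j)), p ^ (m + 1) • (P : geomPoints W) = 0 :=
    fun P ↦ pow_nsmul_eq_zero_of_le (htor P) hj
  -- (1) `g₀` is central modulo `N`
  have hcomm : ∀ g : absoluteGaloisGroup K, ∃ n ∈ N, g₀ * g = g * g₀ * n := by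
    intro g
    refine ⟨(g * g₀)⁻¹ * (g₀ * g), hle (Subgroup.mem_inf.2 ⟨?_, ?_⟩),
      by rw [mul_inv_cancel_left]⟩
    · -- the commutator fixes `E[p^{m+1}]` pointwise: `g₀` is a scalar there
      refine (mem_torsionFixing_iff W _).2 fun P ↦ Subtype.ext ?_
      rw [AddSubgroup.torsionBy.coe_smul, mul_inv_rev, mul_smul, mul_smul, mul_smul]
      have hgP : p ^ (m + 1) • (g • (P : geomPoints W)) = 0 := by
        rw [smul_comm, htor P, smul_zero]
      rw [hg₀c _ hgP, smul_comm g⁻¹ c, inv_smul_smul, ← hg₀c _ (htor P), inv_smul_smul]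
    · -- and lies in `Λ ⊇ [Γ, Γ]`
      have h := hΛ g₀⁻¹ g⁻¹
      rw [inv_inv, inv_inv] at h
      rw [mul_inv_rev, ← mul_assoc]
      exact h
  -- (2) `P ↦ g₀ P − P = (c − 1) P` is a bijection of the `N`-invariants of `E[p^j]`
  have hf : ∀ P : geomTorsion W ((p : ℤ) ^ j), g₀ • P - P = (c - 1) • P := fun P ↦ by
    apply Subtype.ext
    rw [AddSubgroupClass.coe_sub, AddSubgroup.torsionBy.coe_smul, AddSubgroupClass.coe_zsmul,
      hg₀c _ (htor' P), sub_smul, one_smul]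
  haveI : Finite (geomTorsion W ((p : ℤ) ^ j)) :=
    finite_torsionPoints_holds W (AlgebraicClosure K)
      (pow_ne_zero _ (Int.natCast_ne_zero.2 hp.ne_zero))
  have hbij : Set.BijOn (fun x : geomTorsion W ((p : ℤ) ^ j) ↦ g₀ • x - x)
      {x | ∀ n ∈ N, n • x = x} {x | ∀ n ∈ N, n • x = x} := by
    have hmaps : Set.MapsTo (fun x : geomTorsion W ((p : ℤ) ^ j) ↦ g₀ • x - x)
        {x | ∀ n ∈ N, n • x = x} {x | ∀ n ∈ N, n • x = x} := fun x hx n hn ↦ by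
      show n • (g₀ • x - x) = g₀ • x - x
      rw [hf, smul_comm, hx n hn]
    have hinj : Set.InjOn (fun x : geomTorsion W ((p : ℤ) ^ j) ↦ g₀ • x - x)
        {x | ∀ n ∈ N, n • x = x} := fun x _ y _ hxy ↦ by
      simp only [hf] at hxy
      exact zsmul_injOn_of_not_dvd hp hc1 j
        (Subtype.ext (by rw [AddSubgroupClass.coe_nsmul, htor x]; rfl))
        (Subtype.ext (by rw [AddSubgroupClass.coe_nsmul, htor y]; rfl)) hxy
    exact (Set.toFinite _).injOn_iff_bijOn_of_mapsTo hmaps |>.1 hinj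
  exact Rubin1987.subgroupResKer_eq_bot_of_bijOn N hN hcomm hbij

/-- **`E[p]`-coefficients** (Howard's `T̄ = E[p]`): under the hypotheses of
`subgroupResKer_geomTorsion_eq_bot_of_homothety`, `ker (H¹(Γ_K, E[p]) → H¹(N, E[p])) = 0` for every
open normal `N ⊇ Γ_{K(E[p^{m+1}])} ⊓ Λ`.
[cite: Howard2004HeegnerKolyvagin, §2.3 hypothesis H.2 and Lemma 2.6.2] [cite: LawsonWuthrich2016, Lemma 3] -/
theorem subgroupResKer_geomTorsion_prime_eq_bot_of_homothety [W.IsElliptic] (hp : p.Prime) {σ : absoluteGaloisGroup K}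
    {a : ℤ} (hσ : ∀ P : geomTorsion W (p : ℤ), σ • P = a • P) (ha : ¬ (p : ℤ) ∣ a - 1)
    (Λ : Subgroup (absoluteGaloisGroup K)) (hΛ : ∀ g h : absoluteGaloisGroup K, g * h * g⁻¹ * h⁻¹ ∈ Λ) (m : ℕ)
    (N : Subgroup (absoluteGaloisGroup K)) [N.Normal] (hN : IsOpen (N : Set (absoluteGaloisGroup K)))
    (hle : torsionFixing W ((p : ℤ) ^ (m + 1)) ⊓ Λ ≤ N) :
    subgroupResKer (geomTorsion W (p : ℤ)) N = ⊥ := by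
  have h := subgroupResKer_geomTorsion_eq_bot_of_homothety W hp hσ ha Λ hΛ (m := m) (j := 1)
    (by omega) N hN hle
  rwa [pow_one] at h

/-- **Howard's H.2 along a `ℤ_p`-tower** (`κ : ZpExtension K p`, e.g. the anticyclotomic tower of
the Heegner setting). With `σ` a homothety `a` on `E[p]`, `p ∤ a − 1`: for every open normal `N ⊴ Γ_K`
with `Γ_{K(E[p^{m+1}])} ⊓ Gal(K̄/K_∞) ≤ N` — i.e. `N = Gal(K̄/L)` for a finite Galois
`L ⊆ K_∞(E[p^{m+1}]) ⊆ K_∞(E[p^∞])` — and every `j ≤ m + 1`, `ker (H¹(Γ_K, E[p^j]) → H¹(N, E[p^j])) = 0`.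
[cite: Howard2004HeegnerKolyvagin, §2.3 hypothesis H.2 and Lemma 2.6.2; proof of Prop. 3.1.3]
[cite: LawsonWuthrich2016, Lemma 3] -/
theorem subgroupResKer_geomTorsion_eq_bot_of_homothety_ker [W.IsElliptic] [Fact p.Prime] {σ : absoluteGaloisGroup K}
    {a : ℤ} (hσ : ∀ P : geomTorsion W (p : ℤ), σ • P = a • P) (ha : ¬ (p : ℤ) ∣ a - 1)
    (κ : ZpExtension K p) {m j : ℕ} (hj : j ≤ m + 1) (N : Subgroup (absoluteGaloisGroup K)) [N.Normal]
    (hN : IsOpen (N : Set (absoluteGaloisGroup K))) (hle : torsionFixing W ((p : ℤ) ^ (m + 1)) ⊓ κ.kerSubgroup ≤ N) :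
    subgroupResKer (geomTorsion W ((p : ℤ) ^ j)) N = ⊥ := by
  refine subgroupResKer_geomTorsion_eq_bot_of_homothety W Fact.out hσ ha κ.kerSubgroup
    (fun g h ↦ ?_) hj N hN hle
  rw [ZpExtension.mem_kerSubgroup, map_mul, map_mul, map_mul, map_inv, map_inv, mul_inv_cancel_comm,
    mul_inv_cancel]

/-- **Howard's H.2 along a `ℤ_p`-tower, layer form**: the same for every open normal
`N ⊇ Γ_{K(E[p^{m+1}])} ⊓ κ⁻¹(p^b ℤ_p)`, i.e. every finite Galois `L ⊆ K_b(E[p^{m+1}])`.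
[cite: Howard2004HeegnerKolyvagin, §2.3 hypothesis H.2 and Lemma 2.6.2] [cite: LawsonWuthrich2016, Lemma 3] -/
theorem subgroupResKer_geomTorsion_eq_bot_of_homothety_layer [W.IsElliptic] [Fact p.Prime] {σ : absoluteGaloisGroup K}
    {a : ℤ} (hσ : ∀ P : geomTorsion W (p : ℤ), σ • P = a • P) (ha : ¬ (p : ℤ) ∣ a - 1)
    (κ : ZpExtension K p) (b : ℕ) {m j : ℕ} (hj : j ≤ m + 1) (N : Subgroup (absoluteGaloisGroup K)) [N.Normal]
    (hN : IsOpen (N : Set (absoluteGaloisGroup K))) (hle : torsionFixing W ((p : ℤ) ^ (m + 1)) ⊓ κ.layerSubgroup b ≤ N) :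
    subgroupResKer (geomTorsion W ((p : ℤ) ^ j)) N = ⊥ :=
  subgroupResKer_geomTorsion_eq_bot_of_homothety_ker W hσ ha κ hj N hN
    (le_trans (inf_le_inf_left _ (κ.kerSubgroup_le_layerSubgroup b)) hle)

/-- **Howard's H.2, layer form, `E[p]`-coefficients** (Howard's `T̄`): restriction
`H¹(K, E[p]) → H¹(L, E[p])` is injective for every finite Galois `L ⊆ K_b(E[p^{m+1}])` — the
injectivity Howard's Lemma 2.6.2 uses.
[cite: Howard2004HeegnerKolyvagin, §2.3 hypothesis H.2 and Lemma 2.6.2; proof of Prop. 3.1.3]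
[cite: LawsonWuthrich2016, Lemma 3] -/
theorem subgroupResKer_geomTorsion_prime_eq_bot_of_homothety_layer [W.IsElliptic] [Fact p.Prime]
    {σ : absoluteGaloisGroup K} {a : ℤ} (hσ : ∀ P : geomTorsion W (p : ℤ), σ • P = a • P) (ha : ¬ (p : ℤ) ∣ a - 1)
    (κ : ZpExtension K p) (b m : ℕ) (N : Subgroup (absoluteGaloisGroup K)) [N.Normal] (hN : IsOpen (N : Set (absoluteGaloisGroup K)))
    (hle : torsionFixing W ((p : ℤ) ^ (m + 1)) ⊓ κ.layerSubgroup b ≤ N) :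
    subgroupResKer (geomTorsion W (p : ℤ)) N = ⊥ := by
  have h := subgroupResKer_geomTorsion_eq_bot_of_homothety_layer W hσ ha κ b (m := m) (j := 1)
    (by omega) N hN hle
  rwa [pow_one] at h

/-- **The case `a = −1`, `p` odd** (the small-image frames at `p = 3`: `−1 ∈ ρ̄_{E,3}(Γ_K)`): if some
`σ ∈ Γ_K` acts as `−1` on `E[p]`, then `H¹(Gal(L/K), E(L)[p^j]) = 0` for every finite Galois
`L ⊆ K_b(E[p^{m+1}])`, `j ≤ m + 1`.
[cite: Howard2004HeegnerKolyvagin, §2.3 hypothesis H.2 and Lemma 2.6.2] [cite: LawsonWuthrich2016, Lemma 3, Lemma 4] -/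
theorem subgroupResKer_geomTorsion_eq_bot_of_smul_eq_neg [W.IsElliptic] [Fact p.Prime] (hp2 : p ≠ 2)
    {σ : absoluteGaloisGroup K} (hσ : ∀ P : geomTorsion W (p : ℤ), σ • P = -P) (κ : ZpExtension K p) (b : ℕ) {m j : ℕ}
    (hj : j ≤ m + 1) (N : Subgroup (absoluteGaloisGroup K)) [N.Normal] (hN : IsOpen (N : Set (absoluteGaloisGroup K)))
    (hle : torsionFixing W ((p : ℤ) ^ (m + 1)) ⊓ κ.layerSubgroup b ≤ N) :
    subgroupResKer (geomTorsion W ((p : ℤ) ^ j)) N = ⊥ := by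
  refine subgroupResKer_geomTorsion_eq_bot_of_homothety_layer W (a := -1)
    (fun P ↦ by rw [hσ P, neg_one_zsmul]) ?_ κ b hj N hN hle
  rw [show (-1 : ℤ) - 1 = -2 by norm_num, dvd_neg]
  intro h
  have h2 : (p : ℤ) ≤ 2 := Int.le_of_dvd (by norm_num) h
  have := (Fact.out : p.Prime).two_le
  omega

end LawsonWuthrich2016

end Literature.NumberTheory.EllipticCurves

end
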